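import Summits.Ventures.PercRepro.S4MidKeyBase

/-!
# PercRepro — THE MIDDLE KEY AT LEVEL `8`: THE BASE (p1, gen 45; an S4 feeder — p9 owns SUBCLAIM-S4; no window claim here)

The level-`8` ingredients of the middle key (see S4MidKeyBase for level `7`): `topCount_le_sum_uSets_eight` (`#U(p, 8) ≤
Σ_{8 ≤ k ≤ 159} #uSets k`: a `U`-set's complement is a rank-`8` set of `8 … 159` points on the `e`-free core, `f(8) = 159`) and the
numerals `phiK_<word>_eight` (`Φ(p, 8)` for `p = 10 … 30`, from `phiK_eq_two_pow_sub`). Coloops are not excluded. Axioms: standard.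
-/

open scoped Matroid

namespace PercRepro

namespace S4Mid

open Set Finset S2LP S3Mid

variable {α : Type} {M : Matroid α} [M.Finite]

/-- **`#U(p, 8) ≤ Σ_{8 ≤ k ≤ 159} #uSets k`**: the complement of a `U`-set is a rank-`8` set, of `8 … 159` points when every
rank-`8` set has `≤ 159` points. -/
theorem topCount_le_sum_uSets_eight (p : ℕ) (h159 : ∀ X ⊆ M.E, M.eRk X ≤ ((8 : ℕ) : ℕ∞) → X.ncard ≤ 159)
    (hn159 : 159 ≤ M.E.ncard) :
    Matroid.topCount M p 8 ≤ ∑ i ∈ Finset.range 152, (uSets M p 8 (8 + i)).ncard := by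
  rw [topCount_eq_sum_uSets, ← S3LP.sum_Icc_eq_sum_range (fun k => (uSets M p 8 k).ncard) 8 159]
  refine le_of_eq (Finset.sum_subset ?_ ?_).symm
  · intro k hk
    simp only [Finset.mem_Icc] at hk
    simp only [Finset.mem_range]
    omega
  · intro k _ hk
    simp only [Finset.mem_Icc, not_and_or, not_le] at hk
    have h1 := ncard_uSets_le_rkSets (M := M) p 8 k
    rcases hk with hk | hk
    · rw [S3LP.z_lt k 8 hk] at h1; omega
    · rw [rkSets_eq_empty_of_flat h159 le_rfl hk, Set.ncard_empty] at h1; omega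

/-- `Φ(10, 8) = 10 / 9`. -/
theorem phiK_ten_eight : phiK 10 8 = 10 / 9 := by
  rw [HypKey.phiK_eq_two_pow_sub 10 8 (by norm_num), Nat.choose_symm_add]
  simp only [Finset.sum_range_succ, Finset.sum_range_zero]
  norm_num [Nat.choose_eq_descFactorial_div_factorial, Nat.descFactorial_succ, Nat.descFactorial_zero, Nat.factorial]

/-- `Φ(11, 8) = 22 / 9`. -/
theorem phiK_eleven_eight : phiK 11 8 = 22 / 9 := by
  rw [HypKey.phiK_eq_two_pow_sub 11 8 (by norm_num), Nat.choose_symm_add]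
  simp only [Finset.sum_range_succ, Finset.sum_range_zero]
  norm_num [Nat.choose_eq_descFactorial_div_factorial, Nat.descFactorial_succ, Nat.descFactorial_zero, Nat.factorial]

/-- `Φ(12, 8) = 62 / 15`. -/
theorem phiK_twelve_eight : phiK 12 8 = 62 / 15 := by
  rw [HypKey.phiK_eq_two_pow_sub 12 8 (by norm_num), Nat.choose_symm_add]
  simp only [Finset.sum_range_succ, Finset.sum_range_zero]
  norm_num [Nat.choose_eq_descFactorial_div_factorial, Nat.descFactorial_succ, Nat.descFactorial_zero, Nat.factorial]

/-- `Φ(13, 8) = 286 / 45`. -/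
theorem phiK_thirteen_eight : phiK 13 8 = 286 / 45 := by
  rw [HypKey.phiK_eq_two_pow_sub 13 8 (by norm_num), Nat.choose_symm_add]
  simp only [Finset.sum_range_succ, Finset.sum_range_zero]
  norm_num [Nat.choose_eq_descFactorial_div_factorial, Nat.descFactorial_succ, Nat.descFactorial_zero, Nat.factorial]

/-- `Φ(14, 8) = 4634 / 495`. -/
theorem phiK_fourteen_eight : phiK 14 8 = 4634 / 495 := by
  rw [HypKey.phiK_eq_two_pow_sub 14 8 (by norm_num), Nat.choose_symm_add]
  simp only [Finset.sum_range_succ, Finset.sum_range_zero]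
  norm_num [Nat.choose_eq_descFactorial_div_factorial, Nat.descFactorial_succ, Nat.descFactorial_zero, Nat.factorial]

/-- `Φ(15, 8) = 446 / 33`. -/
theorem phiK_fifteen_eight : phiK 15 8 = 446 / 33 := by
  rw [HypKey.phiK_eq_two_pow_sub 15 8 (by norm_num), Nat.choose_symm_add]
  simp only [Finset.sum_range_succ, Finset.sum_range_zero]
  norm_num [Nat.choose_eq_descFactorial_div_factorial, Nat.descFactorial_succ, Nat.descFactorial_zero, Nat.factorial]

/-- `Φ(16, 8) = 1916 / 99`. -/
theorem phiK_sixteen_eight : phiK 16 8 = 1916 / 99 := by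
  rw [HypKey.phiK_eq_two_pow_sub 16 8 (by norm_num), Nat.choose_symm_add]
  simp only [Finset.sum_range_succ, Finset.sum_range_zero]
  norm_num [Nat.choose_eq_descFactorial_div_factorial, Nat.descFactorial_succ, Nat.descFactorial_zero, Nat.factorial]

/-- `Φ(17, 8) = 13702 / 495`. -/
theorem phiK_seventeen_eight : phiK 17 8 = 13702 / 495 := by
  rw [HypKey.phiK_eq_two_pow_sub 17 8 (by norm_num), Nat.choose_symm_add]
  simp only [Finset.sum_range_succ, Finset.sum_range_zero]
  norm_num [Nat.choose_eq_descFactorial_div_factorial, Nat.descFactorial_succ, Nat.descFactorial_zero, Nat.factorial]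

/-- `Φ(18, 8) = 28394 / 715`. -/
theorem phiK_eighteen_eight : phiK 18 8 = 28394 / 715 := by
  rw [HypKey.phiK_eq_two_pow_sub 18 8 (by norm_num), Nat.choose_symm_add]
  simp only [Finset.sum_range_succ, Finset.sum_range_zero]
  norm_num [Nat.choose_eq_descFactorial_div_factorial, Nat.descFactorial_succ, Nat.descFactorial_zero, Nat.factorial]

/-- `Φ(19, 8) = 368714 / 6435`. -/
theorem phiK_nineteen_eight : phiK 19 8 = 368714 / 6435 := by
  rw [HypKey.phiK_eq_two_pow_sub 19 8 (by norm_num), Nat.choose_symm_add]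
  simp only [Finset.sum_range_succ, Finset.sum_range_zero]
  norm_num [Nat.choose_eq_descFactorial_div_factorial, Nat.descFactorial_succ, Nat.descFactorial_zero, Nat.factorial]

/-- `Φ(20, 8) = 750298 / 9009`. -/
theorem phiK_twenty_eight : phiK 20 8 = 750298 / 9009 := by
  rw [HypKey.phiK_eq_two_pow_sub 20 8 (by norm_num), Nat.choose_symm_add]
  simp only [Finset.sum_range_succ, Finset.sum_range_zero]
  norm_num [Nat.choose_eq_descFactorial_div_factorial, Nat.descFactorial_succ, Nat.descFactorial_zero, Nat.factorial]

/-- `Φ(21, 8) = 52366 / 429`. -/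
theorem phiK_twentyone_eight : phiK 21 8 = 52366 / 429 := by
  rw [HypKey.phiK_eq_two_pow_sub 21 8 (by norm_num), Nat.choose_symm_add]
  simp only [Finset.sum_range_succ, Finset.sum_range_zero]
  norm_num [Nat.choose_eq_descFactorial_div_factorial, Nat.descFactorial_succ, Nat.descFactorial_zero, Nat.factorial]

/-- `Φ(22, 8) = 21118 / 117`. -/
theorem phiK_twentytwo_eight : phiK 22 8 = 21118 / 117 := by
  rw [HypKey.phiK_eq_two_pow_sub 22 8 (by norm_num), Nat.choose_symm_add]
  simp only [Finset.sum_range_succ, Finset.sum_range_zero]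
  norm_num [Nat.choose_eq_descFactorial_div_factorial, Nat.descFactorial_succ, Nat.descFactorial_zero, Nat.factorial]

/-- `Φ(23, 8) = 31510 / 117`. -/
theorem phiK_twentythree_eight : phiK 23 8 = 31510 / 117 := by
  rw [HypKey.phiK_eq_two_pow_sub 23 8 (by norm_num), Nat.choose_symm_add]
  simp only [Finset.sum_range_succ, Finset.sum_range_zero]
  norm_num [Nat.choose_eq_descFactorial_div_factorial, Nat.descFactorial_succ, Nat.descFactorial_zero, Nat.factorial]

/-- `Φ(24, 8) = 31627 / 78`. -/
theorem phiK_twentyfour_eight : phiK 24 8 = 31627 / 78 := by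
  rw [HypKey.phiK_eq_two_pow_sub 24 8 (by norm_num), Nat.choose_symm_add]
  simp only [Finset.sum_range_succ, Finset.sum_range_zero]
  norm_num [Nat.choose_eq_descFactorial_div_factorial, Nat.descFactorial_succ, Nat.descFactorial_zero, Nat.factorial]

/-- `Φ(25, 8) = 792625 / 1287`. -/
theorem phiK_twentyfive_eight : phiK 25 8 = 792625 / 1287 := by
  rw [HypKey.phiK_eq_two_pow_sub 25 8 (by norm_num), Nat.choose_symm_add]
  simp only [Finset.sum_range_succ, Finset.sum_range_zero]
  norm_num [Nat.choose_eq_descFactorial_div_factorial, Nat.descFactorial_succ, Nat.descFactorial_zero, Nat.factorial]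

/-- `Φ(26, 8) = 1587824 / 1683`. -/
theorem phiK_twentysix_eight : phiK 26 8 = 1587824 / 1683 := by
  rw [HypKey.phiK_eq_two_pow_sub 26 8 (by norm_num), Nat.choose_symm_add]
  simp only [Finset.sum_range_succ, Finset.sum_range_zero]
  norm_num [Nat.choose_eq_descFactorial_div_factorial, Nat.descFactorial_succ, Nat.descFactorial_zero, Nat.factorial]

/-- `Φ(27, 8) = 9537042 / 6545`. -/
theorem phiK_twentyseven_eight : phiK 27 8 = 9537042 / 6545 := by
  rw [HypKey.phiK_eq_two_pow_sub 27 8 (by norm_num), Nat.choose_symm_add]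
  simp only [Finset.sum_range_succ, Finset.sum_range_zero]
  norm_num [Nat.choose_eq_descFactorial_div_factorial, Nat.descFactorial_succ, Nat.descFactorial_zero, Nat.factorial]

/-- `Φ(28, 8) = 19087174 / 8415`. -/
theorem phiK_twentyeight_eight : phiK 28 8 = 19087174 / 8415 := by
  rw [HypKey.phiK_eq_two_pow_sub 28 8 (by norm_num), Nat.choose_symm_add]
  simp only [Finset.sum_range_succ, Finset.sum_range_zero]
  norm_num [Nat.choose_eq_descFactorial_div_factorial, Nat.descFactorial_succ, Nat.descFactorial_zero, Nat.factorial]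

/-- `Φ(29, 8) = 29933626 / 8415`. -/
theorem phiK_twentynine_eight : phiK 29 8 = 29933626 / 8415 := by
  rw [HypKey.phiK_eq_two_pow_sub 29 8 (by norm_num), Nat.choose_symm_add]
  simp only [Finset.sum_range_succ, Finset.sum_range_zero]
  norm_num [Nat.choose_eq_descFactorial_div_factorial, Nat.descFactorial_succ, Nat.descFactorial_zero, Nat.factorial]

/-- `Φ(30, 8) = 59884082 / 10659`. -/
theorem phiK_thirty_eight : phiK 30 8 = 59884082 / 10659 := by
  rw [HypKey.phiK_eq_two_pow_sub 30 8 (by norm_num), Nat.choose_symm_add]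
  simp only [Finset.sum_range_succ, Finset.sum_range_zero]
  norm_num [Nat.choose_eq_descFactorial_div_factorial, Nat.descFactorial_succ, Nat.descFactorial_zero, Nat.factorial]

end S4Mid

end PercRepro
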